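import Literature.NumberTheory.GaloisRepresentations.RestrictedRamificationOpenSubgroupLayers
import Mathlib.NumberTheory.NumberField.InfinitePlace.TotallyRealComplex
import Mathlib.FieldTheory.Galois.Infinite
import HarnessLib

/-!
# Complex places in a finite extension of a TOTALLY COMPLEX field (no Galois hypothesis), and the
# number of complex places of the fixed field `K̄^H` of an open subgroup `H ≤ Γ_K` / `U ≤ G_{K,S}`

Topic `NumberTheory/GaloisRepresentations`; namespace `Literature.NumberTheory.GaloisRepresentations`.
THEOREMS ONLY (no definition, no named fact, no `sorry`, no instance; D-0026).  Lane «TATE-EPC-TC»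
of cell `bsd-eis` (crux `GoodLatticeBDPValue`, stmt-BirchSwinnertonDyer-19032), the LEAD's piece
«delta (ii)» of the adapter between brick B8-arith's class identity (exponent
`nrComplexPlaces ↥(baseField H)`, width seat w4 gen 17, `additive_coindOpen_mu_euler_of_brauerClass`)
and brick (E)'s base case / B9's `BASE_K` (exponent `U.index * nrComplexPlaces K`, width seats w7
gen 9 / w2 gen 9, `baseK_of_coindMuEuler`, `tateGlobalEulerPoincareCharacteristic_of_isTotallyComplex_of_base`).

Elementary facts (Neukirch, *ANT*, Ch. III §3 / Cassels–Fröhlich, Ch. VII §8.3: at a COMPLEX place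
`v` of `F` every extension `E/F` is "unramified at `v`", so `v` has exactly `[E : F]` places of `E`
above it).  Mathlib has the count `#S_∞(E) = [E : F] · #S_∞(F)` only for `E/F` GALOIS and unramified at
infinity (`IsUnramifiedAtInfinitePlaces.card_infinitePlace`; the tree's `InfinitePlaceTotallyComplexBase`
= w6 gen 9's B7d is the Galois case); here the base is totally complex and `E/F` arbitrary finite, and
the proof is pure counting: `[L : ℚ] = 2 · r₂(L)` for totally complex `L` (Mathlib
`IsTotallyComplex.finrank`) and the tower law.

* §1 `nrComplexPlaces_eq_finrank_mul_of_isTotallyComplex` — `F` totally complex, `E/F` finite: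
  `r₂(E) = [E : F] · r₂(F)`; `card_infinitePlace_eq_finrank_mul_of_isTotallyComplex` — the same for
  `#S_∞`.
* §2 `OpenSubgroupLayer.finrank_baseField_eq_index` — for a CLOSED subgroup `H ≤ Γ_K` of the absolute
  Galois group, `[K̄^H : K] = [Γ_K : H]` (infinite Galois theory, Mathlib
  `InfiniteGalois.fixingSubgroup_fixedField` + `IntermediateField.finrank_eq_fixingSubgroup_index`;
  both sides `0` when the index is infinite); `nrComplexPlaces_baseField_eq_index_mul` — `K` totally
  complex: `r₂(K̄^H) = [Γ_K : H] · r₂(K)`.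
* §3 the `G_{K,S}`-currency: `index_galoisGroupAbove` (`[G_S : H N_S/N_S] = [Γ_K : H]` for `N_S ≤ H`),
  `nrComplexPlaces_baseField_eq_index_galoisGroupAbove_mul`, and, for an OPEN `U ≤ G_{K,S}` with
  `H := U.comap (Γ_K ↠ G_{K,S})`: `galoisGroupAbove_comap_toUnramifiedQuot` (`= U`),
  `nrComplexPlaces_baseField_comap_eq_index_mul` (`r₂(K̄^H) = [G_S : U] · r₂(K)`).

## References
* J. Neukirch, *Algebraic Number Theory* (1999), Ch. III §3 (extension of infinite places), Ch. IV §1.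
  [NeukirchANT1999]
* J. W. S. Cassels, A. Fröhlich (eds.), *Algebraic Number Theory* (1967), Ch. VII §8.3. [CasselsFrohlichANT1967]
* J. Neukirch, A. Schmidt, K. Wingberg, *Cohomology of Number Fields*, 2nd ed. (2008), VIII §3,
  (8.7.4). [NeukirchSchmidtWingberg2008]
-/

noncomputable section

open Function NumberField NumberField.InfinitePlace Field IsDedekindDomain
open scoped NumberField
open Literature.NumberTheory.IwasawaTheory.Greenberg2006 (galoisGroupAbove mem_galoisGroupAbove_iff)

namespace Literature.NumberTheory.GaloisRepresentations

/-! ## §1. Finite extensions of a totally complex field -/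

section Field

variable (F E : Type*) [Field F] [NumberField F] [Field E] [NumberField E] [Algebra F E]

/-- **`r₂(E) = [E : F] · r₂(F)`** for a finite extension `E` of a TOTALLY COMPLEX number field `F`
(no Galois hypothesis): `E` is totally complex, `[E : ℚ] = 2 r₂(E)`, `[F : ℚ] = 2 r₂(F)`, and
`[E : ℚ] = [F : ℚ]·[E : F]`. [cite: NeukirchANT1999, Ch. III §3] [cite: CasselsFrohlichANT1967, Ch. VII §8.3] -/
theorem nrComplexPlaces_eq_finrank_mul_of_isTotallyComplex [IsTotallyComplex F] :
    nrComplexPlaces E = Module.finrank F E * nrComplexPlaces F := by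
  haveI : IsTotallyComplex E := isTotallyComplex_of_algebra F E
  have hE : Module.finrank ℚ E = 2 * nrComplexPlaces E := IsTotallyComplex.finrank (K := E)
  have hF : Module.finrank ℚ F = 2 * nrComplexPlaces F := IsTotallyComplex.finrank (K := F)
  have htower : Module.finrank ℚ F * Module.finrank F E = Module.finrank ℚ E :=
    Module.finrank_mul_finrank ℚ F E
  have h2 : 2 * nrComplexPlaces E = 2 * (Module.finrank F E * nrComplexPlaces F) := by
    rw [← hE, ← htower, hF]; ring
  omega

/-- **`#S_∞(E) = [E : F] · #S_∞(F)`** for a finite extension `E` of a totally complex number field `F`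
(every infinite place is complex on both sides). [cite: NeukirchANT1999, Ch. III §3] -/
theorem card_infinitePlace_eq_finrank_mul_of_isTotallyComplex [IsTotallyComplex F] :
    Fintype.card (InfinitePlace E) = Module.finrank F E * Fintype.card (InfinitePlace F) := by
  haveI : IsTotallyComplex E := isTotallyComplex_of_algebra F E
  have hE := card_eq_nrRealPlaces_add_nrComplexPlaces (K := E)
  have hF := card_eq_nrRealPlaces_add_nrComplexPlaces (K := F)
  rw [IsTotallyComplex.nrRealPlaces_eq_zero, zero_add] at hE hF
  rw [hE, hF, nrComplexPlaces_eq_finrank_mul_of_isTotallyComplex F E]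

/-- `Nat.card` form of `card_infinitePlace_eq_finrank_mul_of_isTotallyComplex`.
[cite: NeukirchANT1999, Ch. III §3] -/
theorem natCard_infinitePlace_eq_finrank_mul_of_isTotallyComplex [IsTotallyComplex F] :
    Nat.card (InfinitePlace E) = Module.finrank F E * Nat.card (InfinitePlace F) := by
  rw [Nat.card_eq_fintype_card, Nat.card_eq_fintype_card,
    card_infinitePlace_eq_finrank_mul_of_isTotallyComplex F E]

end Field

/-! ## §2. The fixed field `K̄^H` of a closed subgroup `H ≤ Γ_K` -/

namespace OpenSubgroupLayer

variable {K : Type} [Field K] [NumberField K] (H : Subgroup (absoluteGaloisGroup K))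

/-- **`[K̄^H : K] = [Γ_K : H]`** for a CLOSED subgroup `H` of the absolute Galois group (infinite Galois
theory: the fixing subgroup of `K̄^H` is `H`, and the degree of an intermediate field of a Galois
extension is the index of its fixing subgroup; both sides are `0` for infinite index).
[cite: NeukirchANT1999, Ch. IV (1.2)] -/
theorem finrank_baseField_eq_index (hH : IsClosed (H : Set (absoluteGaloisGroup K))) :
    Module.finrank K (baseField H) = H.index := by
  rw [IntermediateField.finrank_eq_fixingSubgroup_index]
  have h := InfiniteGalois.fixingSubgroup_fixedField
    (⟨(H : Subgroup (AlgebraicClosure K ≃ₐ[K] AlgebraicClosure K)), hH⟩ :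
      ClosedSubgroup (AlgebraicClosure K ≃ₐ[K] AlgebraicClosure K))
  exact congrArg Subgroup.index h

/-- **`r₂(K̄^H) = [Γ_K : H] · r₂(K)`** for `K` totally complex and `H ≤ Γ_K` closed with `K̄^H` a number
field (e.g. `H` open). [cite: NeukirchANT1999, Ch. III §3, Ch. IV (1.2)] -/
theorem nrComplexPlaces_baseField_eq_index_mul [IsTotallyComplex K] [NumberField (baseField H)]
    (hH : IsClosed (H : Set (absoluteGaloisGroup K))) :
    nrComplexPlaces (baseField H) = H.index * nrComplexPlaces K := by
  rw [nrComplexPlaces_eq_finrank_mul_of_isTotallyComplex K (baseField H), finrank_baseField_eq_index H hH]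

/-! ## §3. The `G_{K,S}`-currency -/

variable (S : Set (HeightOneSpectrum (𝓞 K)))

omit [NumberField K] in
/-- **`[G_{K,S} : U] = [Γ_K : H]`** for `U = galoisGroupAbove S H = H N_S / N_S` when `N_S ≤ H`.
[cite: NeukirchSchmidtWingberg2008, VIII §3] -/
theorem index_galoisGroupAbove (hNH : ramificationSubgroup K S ≤ H) :
    (galoisGroupAbove S H).index = H.index :=
  Subgroup.index_map_eq H (toUnramifiedQuot_surjective K S) (by rwa [QuotientGroup.ker_mk'])

/-- **`r₂(K̄^H) = [G_{K,S} : galoisGroupAbove S H] · r₂(K)`** (`K` totally complex, `N_S ≤ H` closed,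
`K̄^H` a number field) — the exponent bridge between brick B8-arith (`nrComplexPlaces ↥(baseField H)`)
and `BASE_K` (`U.index * nrComplexPlaces K`). [cite: NeukirchSchmidtWingberg2008, VIII §3, (8.7.4)] -/
theorem nrComplexPlaces_baseField_eq_index_galoisGroupAbove_mul [IsTotallyComplex K]
    [NumberField (baseField H)] (hH : IsClosed (H : Set (absoluteGaloisGroup K)))
    (hNH : ramificationSubgroup K S ≤ H) :
    nrComplexPlaces (baseField H) = (galoisGroupAbove S H).index * nrComplexPlaces K := by
  rw [index_galoisGroupAbove H S hNH, nrComplexPlaces_baseField_eq_index_mul H hH]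

variable {S}

omit [NumberField K] in
/-- For `U ≤ G_{K,S}` and `H := U.comap (Γ_K ↠ G_{K,S})`: `N_S ≤ H`. [cite: NeukirchSchmidtWingberg2008, VIII §3] -/
theorem ramificationSubgroup_le_comap_toUnramifiedQuot (U : Subgroup (GaloisGroupUnramifiedOutside K S)) :
    ramificationSubgroup K S ≤ U.comap (toUnramifiedQuot K S) := by
  intro σ hσ
  have h1 : toUnramifiedQuot K S σ = 1 := (QuotientGroup.eq_one_iff σ).2 hσ
  rw [Subgroup.mem_comap, h1]
  exact one_mem U

omit [NumberField K] in
/-- For `U ≤ G_{K,S}` and `H := U.comap (Γ_K ↠ G_{K,S})`: `galoisGroupAbove S H = U`.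
[cite: NeukirchSchmidtWingberg2008, VIII §3] -/
theorem galoisGroupAbove_comap_toUnramifiedQuot (U : Subgroup (GaloisGroupUnramifiedOutside K S)) :
    galoisGroupAbove S (U.comap (toUnramifiedQuot K S)) = U :=
  Subgroup.map_comap_eq_self_of_surjective (toUnramifiedQuot_surjective K S) U

omit [NumberField K] in
/-- For `U ≤ G_{K,S}` and `H := U.comap (Γ_K ↠ G_{K,S})`: `[Γ_K : H] = [G_{K,S} : U]`.
[cite: NeukirchSchmidtWingberg2008, VIII §3] -/
theorem index_comap_toUnramifiedQuot (U : Subgroup (GaloisGroupUnramifiedOutside K S)) :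
    (U.comap (toUnramifiedQuot K S)).index = U.index :=
  Subgroup.index_comap_of_surjective U (toUnramifiedQuot_surjective K S)

omit [NumberField K] in
/-- For an OPEN (hence closed) `U ≤ G_{K,S}`, `H := U.comap (Γ_K ↠ G_{K,S})` is closed in `Γ_K`.
[cite: NeukirchSchmidtWingberg2008, VIII §3] -/
theorem isClosed_comap_toUnramifiedQuot (U : Subgroup (GaloisGroupUnramifiedOutside K S))
    (hU : IsOpen (U : Set (GaloisGroupUnramifiedOutside K S))) :
    IsClosed ((U.comap (toUnramifiedQuot K S) : Subgroup (absoluteGaloisGroup K)) :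
      Set (absoluteGaloisGroup K)) :=
  (Subgroup.isClosed_of_isOpen U hU).preimage (continuous_toUnramifiedQuot K S)

/-- **`r₂(K̄^H) = [G_{K,S} : U] · r₂(K)`** for `K` totally complex, `U ≤ G_{K,S}` OPEN and
`H := U.comap (Γ_K ↠ G_{K,S})` (with `K̄^H` a number field) — the form read by the adapter feeding
`baseK_of_coindMuEuler` (`U = C.comap (QuotientGroup.mk' W)`). [cite: NeukirchSchmidtWingberg2008, VIII §3, (8.7.4)] -/
theorem nrComplexPlaces_baseField_comap_eq_index_mul [IsTotallyComplex K]
    (U : Subgroup (GaloisGroupUnramifiedOutside K S)) (hU : IsOpen (U : Set (GaloisGroupUnramifiedOutside K S)))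
    [NumberField (baseField (U.comap (toUnramifiedQuot K S)))] :
    nrComplexPlaces (baseField (U.comap (toUnramifiedQuot K S))) = U.index * nrComplexPlaces K := by
  rw [nrComplexPlaces_baseField_eq_index_mul _ (isClosed_comap_toUnramifiedQuot U hU),
    index_comap_toUnramifiedQuot U]

end OpenSubgroupLayer

end Literature.NumberTheory.GaloisRepresentations

end
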